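import Summits.Ventures.Crystal3D.Theorems.StickyWulffConstantCoaxialWallLawInPlaneCell
import Summits.Ventures.Crystal3D.Theorems.StickyWulffConstantCoaxialWallLawInPlaneSlotSharp
import Summits.Ventures.Crystal3D.Theorems.StickyWulffConstantCoaxialWallLawTerracePropagation
import Summits.Ventures.Crystal3D.Theorems.StickyWulffConstantCoaxialWallLawInteriorLedger
import Summits.Ventures.Crystal3D.Theorems.StickyWulffConstantCoaxialWallLawHaggConst
import Summits.Ventures.Crystal3D.Theorems.StickyWulffConstantGenericWallFloorCoaxialIff
import Summits.Ventures.Crystal3D.Theorems.StickyWulffConstantGenericWallFloorSampleDeficitUpper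
import Summits.Ventures.Crystal3D.Theorems.StickyWulffConstantGenericWallFloorRigidRung
import Summits.Ventures.Crystal3D.Theorems.StickyWulffConstantNoReconstructionGainLatticeAdhesion
import HarnessLib

/-!
# The IN-PLANE NET rung of `stub_coaxialTwoSlabAdhesion`: general fillings, ALL twin pairs, NO residual, NO regime, h-uniform

HONEST FRAMING. Part of the venture `Summits/Ventures/Crystal3D` (cell `crystal3d-full`), helper
`--supports` the crux `CoaxialWallLaw` (stmt-Ventures-19481, `route-Ventures-StickyWulffConstant`),
REGISTERED line `WallLedgerF` (planner cf-p1 gen 16), open stub `stub_coaxialTwoSlabAdhesion`.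
RUNG CREDIT ONLY — this is NOT the stub: it is the stub's inequality for ARBITRARY fillings `X` of the cell
and ALL co-axial TWIN pairs (`A₁·Λ₀ ≠ A₂·Λ₀`), at EVERY inclination, with NO residual, and with the crux's
constant `½` replaced by `√6/11440`; the kissing facts `KissingGap δ` / `KissingClassification δ` are taken BY
NAME (inputs, as everywhere on this line).  It is the assembly of the IN-PLANE-ROOTED v2 word automaton (memo
F-FRONTIER-g5 §4(a′), evidence on the crux item): 19481-p2's NET line automaton (`…WordCore`/`…WordInstance`,
residual-free) rooted at the SHARP IN-PLANE riser slot of `…InPlaneSlotSharp` instead of the steep far slot, for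
which no line ever reaches the top sample (`…WordNoTop`: no well-formed word carries the twin's slot dozen), so
that NO capacity is subtracted and NO condition on the inclination is needed.  This file is the text of
19481-p2's v1 assembly `coaxialTwoSlabAdhesion_general_twin_fluxGap` (`…FluxGapTwin`) with the cell lemma
replaced by `wordNet_twin_payers_ge_inPlane` (`…InPlaneCell`).

**Theorem (`coaxialTwoSlabAdhesion_general_twin_inPlane`).**  Under the crux's co-axiality data
(`L, s₁, s₂, σ, σ'`) and `A₁·Λ₀ ≠ A₂·Λ₀`: there are `C` and `R₀ = 10` such that for every `h ≥ 0`, `ρ ≥ R₀`,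
every `1`-separated `X` in the cell with the two complete slab samples `P₁ ⊆ X`, `P₂ ⊆ X ∖ P₁`,

  `cross(P₁, X∖P₁) + cross(P₂, Y) ≤ D(Y) + (φ₁ + φ₂ − (√6/11440)·√(1 − ⟪L e₃, e₃⟫²)) π ρ² + C (1 + h) ρ`.

THE FIRST h-UNIFORM, RESIDUAL-FREE GENERAL-FILLING WALL LAW FOR CO-AXIAL TWINS: every wall between a grain and
its (lamination-)twin, whatever the filling and the thickness, costs at least `(√6/11440)·sin θ·πρ²` beyond the two
outer faces.  Proof.  `cross₁ + cross₂ = D(P₁) + D(P₂) + D(Y) − D(X)`; `D(Pᵢ) ≤ 2φᵢ π ρ² + Cᵢ ρ`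
(`affineSampleDeficit_upper`); `2 D(X) ≥ 2φ₁πρ² + 2φ₂πρ² + #{deg ≠ 12 in the interior window} − O((1+h)ρ)`
(`ledger_ge_faces_add_interior`); `2860·#{deg ≤ 11} ≥ √2 α π ρ² − O(ρ)` (`wordNet_twin_payers_ge_inPlane`) for
the sharp in-plane slot `w` (`⟪A₁ w, L e₃⟫ = 0`, `√2 α = √2 (A₁w)₂ ≥ (√6/2) sin θ`,
`exists_inPlane_slot_of_coaxial_sharp`); if `α = 0` then `sin θ = 0` and the ledger alone suffices.

WHAT THIS IS NOT: not the stub (translation pairs `A₁·Λ₀ = A₂·Λ₀` are not covered — they keep the coset flux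
gap of `…FluxGapCellTrans`; constant `√6/11440 < ½` — sharp local accounting (`…EndStar`, C12-55) and the
end-multiplicity are the remaining factors); F-C1 not moved.
-/
noncomputable section

namespace Summit.Ventures.Crystal3D.Theorems

open Summit.Ventures.Crystal3D Finset
open Literature.MathematicalPhysics.StatisticalMechanics (fccStacking barlowStacking IsHaggSeq
  contactDeficiency)
open scoped InnerProductSpace

open scoped Classical in
/-- **The in-plane NET rung of `stub_coaxialTwoSlabAdhesion` (general fillings, all twin pairs, no residual, no
regime).**  See the module docstring. -/
theorem coaxialTwoSlabAdhesion_general_twin_inPlane {δ : ℝ} (hg : KissingGap δ) (hc : KissingClassification δ)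
    (A₁ : EuclideanSpace ℝ (Fin 3) ≃ₗᵢ[ℝ] EuclideanSpace ℝ (Fin 3)) (t₁ : EuclideanSpace ℝ (Fin 3))
    (A₂ : EuclideanSpace ℝ (Fin 3) ≃ₗᵢ[ℝ] EuclideanSpace ℝ (Fin 3)) (t₂ : EuclideanSpace ℝ (Fin 3))
    (L : EuclideanSpace ℝ (Fin 3) ≃ₗᵢ[ℝ] EuclideanSpace ℝ (Fin 3)) (s₁ s₂ : EuclideanSpace ℝ (Fin 3))
    (σ σ' : ℤ → ℤ) (hσ : IsHaggSeq σ) (hσ' : IsHaggSeq σ')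
    (hsub₁ : (fun p => A₁ p + t₁) '' fccStacking 1 (Real.sqrt (2 / 3)) ⊆
      (fun p => L p + s₁) '' barlowStacking 1 (Real.sqrt (2 / 3)) σ)
    (hsub₂ : (fun p => A₂ p + t₂) '' fccStacking 1 (Real.sqrt (2 / 3)) ⊆
      (fun p => L p + s₂) '' barlowStacking 1 (Real.sqrt (2 / 3)) σ')
    (htwin : A₁ '' fccStacking 1 (Real.sqrt (2 / 3)) ≠ A₂ '' fccStacking 1 (Real.sqrt (2 / 3))) :
    ∃ C R₀ : ℝ, 1 ≤ R₀ ∧ ∀ h : ℝ, 0 ≤ h → ∀ ρ : ℝ, R₀ ≤ ρ →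
      ∀ X P₁ P₂ : Finset (EuclideanSpace ℝ (Fin 3)),
      (∀ p ∈ X, ∀ q ∈ X, p ≠ q → 1 ≤ dist p q) → P₁ ⊆ X → P₂ ⊆ X \ P₁ →
      (∀ p ∈ X, -(2 * R₀) ≤ p 2 ∧ p 2 ≤ h + 2 * R₀ ∧ p 0 ^ 2 + p 1 ^ 2 ≤ ρ ^ 2) →
      (∀ p, p ∈ P₁ ↔ (p ∈ (fun q => A₁ q + t₁) '' fccStacking 1 (Real.sqrt (2 / 3)) ∧
        -(2 * R₀) ≤ p 2 ∧ p 2 ≤ -R₀ ∧ p 0 ^ 2 + p 1 ^ 2 ≤ ρ ^ 2)) →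
      (∀ p, p ∈ P₂ ↔ (p ∈ (fun q => A₂ q + t₂) '' fccStacking 1 (Real.sqrt (2 / 3)) ∧
        h + R₀ ≤ p 2 ∧ p 2 ≤ h + 2 * R₀ ∧ p 0 ^ 2 + p 1 ^ 2 ≤ ρ ^ 2)) →
      ((((P₁ ×ˢ (X \ P₁)).filter fun pq => dist pq.1 pq.2 = 1).card : ℕ) : ℝ) +
        ((((P₂ ×ˢ ((X \ P₁) \ P₂)).filter fun pq => dist pq.1 pq.2 = 1).card : ℕ) : ℝ) ≤
        contactDeficiency ((X \ P₁) \ P₂) +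
          (Real.sqrt 2 / 4 * ∑ᶠ w ∈ {w ∈ fccStacking 1 (Real.sqrt (2 / 3)) | ‖w‖ = 1},
              |⟪w, A₁.symm (EuclideanSpace.single (2 : Fin 3) (1 : ℝ))⟫_ℝ| +
            Real.sqrt 2 / 4 * ∑ᶠ w ∈ {w ∈ fccStacking 1 (Real.sqrt (2 / 3)) | ‖w‖ = 1},
              |⟪w, A₂.symm (EuclideanSpace.single (2 : Fin 3) (1 : ℝ))⟫_ℝ| -
            (Real.sqrt 6 / 11440 : ℝ) * Real.sqrt (1 - ⟪L (EuclideanSpace.single (2 : Fin 3) (1 : ℝ)),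
              (EuclideanSpace.single (2 : Fin 3) (1 : ℝ))⟫_ℝ ^ 2)) * Real.pi * ρ ^ 2 +
          C * (1 + h) * ρ := by
  set e₃ : EuclideanSpace ℝ (Fin 3) := EuclideanSpace.single (2 : Fin 3) (1 : ℝ) with he₃
  set RL : EuclideanSpace ℝ (Fin 3) ≃ₗᵢ[ℝ] EuclideanSpace ℝ (Fin 3) :=
    (ℝ ∙ EuclideanSpace.single (2 : Fin 3) (1 : ℝ)).reflection.trans L with hRL
  have hr : 0 < Real.sqrt (2 / 3) := Real.sqrt_pos.2 (by norm_num)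
  have he₃1 : ‖e₃‖ = 1 := by rw [he₃, PiLp.norm_single, norm_one]
  obtain ⟨C₁, hC₁⟩ := affineSampleDeficit_upper A₁ t₁ 10 (by norm_num)
  obtain ⟨C₂, hC₂⟩ := affineSampleDeficit_upper A₂ t₂ 10 (by norm_num)
  -- the pair is a twin pair in the frame: `σ 0 ≠ σ' 0`
  have htw : σ 0 ≠ σ' 0 := by
    intro heq
    obtain ⟨-, e₁⟩ := linear_image_eq_frame_of_subset A₁ L t₁ s₁ hσ hsub₁
    obtain ⟨-, e₂⟩ := linear_image_eq_frame_of_subset A₂ L t₂ s₂ hσ' hsub₂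
    exact htwin (by rw [e₁, e₂, heq])
  -- normal form: the grains are `F false·Λ₀ + s₁`, `F true·Λ₀ + s₂` with `{F false, F true} = {L, L∘R}`
  have hnorm : ∃ F : Bool → (EuclideanSpace ℝ (Fin 3) ≃ₗᵢ[ℝ] EuclideanSpace ℝ (Fin 3)),
      ((F false = L ∧ F true = RL) ∨ (F false = RL ∧ F true = L)) ∧
      (fun q => A₁ q + t₁) '' fccStacking 1 (Real.sqrt (2 / 3)) =
        (fun q => F false q + s₁) '' fccStacking 1 (Real.sqrt (2 / 3)) ∧
      (fun q => A₂ q + t₂) '' fccStacking 1 (Real.sqrt (2 / 3)) =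
        (fun q => F true q + s₂) '' fccStacking 1 (Real.sqrt (2 / 3)) := by
    rcases hσ 0 with h1 | hm1
    · have hm1' : σ' 0 = -1 := (hσ' 0).resolve_left fun h' => htw (h1.trans h'.symm)
      have e₁ := coaxial_frame_eq_fcc_of_one A₁ t₁ L s₁ hσ hsub₁ h1
      obtain ⟨e₂, -⟩ := coaxial_frame_eq_fcc_of_neg_one A₂ t₂ L s₂ hσ' hsub₂ hm1'
      exact ⟨fun c => cond c RL L, Or.inl ⟨rfl, rfl⟩, e₁, e₂⟩
    · have h1' : σ' 0 = 1 := (hσ' 0).resolve_right fun h' => htw (hm1.trans h'.symm)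
      obtain ⟨e₁, -⟩ := coaxial_frame_eq_fcc_of_neg_one A₁ t₁ L s₁ hσ hsub₁ hm1
      have e₂ := coaxial_frame_eq_fcc_of_one A₂ t₂ L s₂ hσ' hsub₂ h1'
      exact ⟨fun c => cond c L RL, Or.inr ⟨rfl, rfl⟩, e₁, e₂⟩
  obtain ⟨F, hF, e₁, e₂⟩ := hnorm
  -- the axis `n = L e₃`
  obtain ⟨n, hn⟩ : ∃ n : EuclideanSpace ℝ (Fin 3), n = L e₃ ∨ n = -L e₃ := ⟨L e₃, Or.inl rfl⟩
  -- the sharp in-plane slot of the bottom frame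
  have hsubF : (fun p => F false p + s₁) '' fccStacking 1 (Real.sqrt (2 / 3)) ⊆
      (fun p => L p + s₁) '' barlowStacking 1 (Real.sqrt (2 / 3)) σ := by rw [← e₁]; exact hsub₁
  obtain ⟨u, huS, hu0, huup, hflux⟩ := exists_inPlane_slot_of_coaxial_sharp (F false) s₁ L s₁ hσ hsubF
  have hun : ⟪F false u, n⟫_ℝ = 0 := by
    rcases hn with h' | h'
    · rw [h']; exact hu0
    · rw [h', inner_neg_right, hu0, neg_zero]
  have h2a : (F false u) 2 = ⟪F false u, e₃⟫_ℝ := apply_two_eq_inner_e₃ _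
  set s : ℝ := Real.sqrt (1 - ⟪L e₃, e₃⟫_ℝ ^ 2) with hs
  have hs0 : 0 ≤ s := Real.sqrt_nonneg _
  -- the flux of the in-plane slot beats `(√6/2) sin θ`
  have h63 : Real.sqrt 6 / 2 * s ≤ Real.sqrt 2 * (F false u) 2 := by
    rw [h2a, ← abs_of_nonneg huup]; linarith only [hflux]
  -- the constant
  have hCE0 : (0 : ℝ) ≤ 12 * Real.sqrt 2 * Real.pi + 36 * 10 + 55440 := by positivity
  refine ⟨|C₁| + |C₂| + (240 * Real.sqrt 2 * Real.pi + 3120 * (4 * 10 + 2)) / 2 +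
    (12 * Real.sqrt 2 * Real.pi + 36 * 10 + 55440) / 5720, 10, by norm_num, ?_⟩
  intro h hh ρ hρ X P₁ P₂ hX hP₁X hP₂X₁ hcyl hP₁ hP₂
  set φ₁ : ℝ := Real.sqrt 2 / 4 * ∑ᶠ w ∈ {w ∈ fccStacking 1 (Real.sqrt (2 / 3)) | ‖w‖ = 1},
      |⟪w, A₁.symm e₃⟫_ℝ| with hφ₁
  set φ₂ : ℝ := Real.sqrt 2 / 4 * ∑ᶠ w ∈ {w ∈ fccStacking 1 (Real.sqrt (2 / 3)) | ‖w‖ = 1},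
      |⟪w, A₂.symm e₃⟫_ℝ| with hφ₂
  have hP₂X : P₂ ⊆ X := hP₂X₁.trans sdiff_subset
  have hρ0 : (0 : ℝ) ≤ ρ := by linarith
  -- (1) the two slab samples from above
  have hD₁ := hC₁ (-(2 * 10)) (-10) (by norm_num) ρ hρ P₁ hP₁
  have hD₂ := hC₂ (h + 10) (h + 2 * 10) (by ring) ρ hρ P₂ hP₂
  -- (2) the interior ledger
  have hled := ledger_ge_faces_add_interior A₁ t₁ A₂ t₂ X P₁ P₂ 10 h ρ le_rfl hh hρ hX hcyl hP₁X hP₂X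
    hP₁ hP₂
  have hf₁ : Real.sqrt 2 / 4 * ∑ w ∈ fccSlots, |⟪A₁ w, e₃⟫_ℝ| = φ₁ := by
    rw [hφ₁, finsum_unit_fcc_symm_eq_sum_slots]
  have hf₂ : Real.sqrt 2 / 4 * ∑ w ∈ fccSlots, |⟪A₂ w, e₃⟫_ℝ| = φ₂ := by
    rw [hφ₂, finsum_unit_fcc_symm_eq_sum_slots]
  rw [hf₁, hf₂, ← two_mul_contactDeficiency_eq_sum X] at hled
  -- (3) the payers of the interior window, fed by the in-plane lines (if they rise)
  have hP₁' := hP₁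
  have hP₂' := hP₂
  simp only [e₁, e₂] at hP₁' hP₂'
  have hpay : Real.sqrt 6 / 2 * s * Real.pi * ρ ^ 2 - (12 * Real.sqrt 2 * Real.pi + 36 * 10 + 55440) * ρ ≤
      2860 * ((X.filter fun z => (X.filter fun q => dist z q = 1).card ≤ 11 ∧
        -10 - 2 ≤ z 2 ∧ z 2 ≤ h + 10 + 2).card : ℝ) := by
    by_cases hα : 0 < (F false u) 2
    · have hcellpay := wordNet_twin_payers_ge_inPlane hg hc L F hF hn huS hun hα s₁ s₂ X P₁ P₂ 10 h ρ
        le_rfl hh hρ hX hcyl hP₁X hP₂X hP₁' hP₂'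
      have hπρ : 0 ≤ Real.pi * ρ ^ 2 := by positivity
      have hflux' : Real.sqrt 6 / 2 * s * Real.pi * ρ ^ 2 ≤ Real.sqrt 2 * (F false u) 2 * Real.pi * ρ ^ 2 := by
        have := mul_le_mul_of_nonneg_right h63 hπρ
        simp only [mul_assoc] at this ⊢
        exact this
      refine le_trans ?_ hcellpay
      linarith only [hflux']
    · -- the in-plane slot is horizontal: `sin θ = 0`
      push Not at hα
      have hα0 : (F false u) 2 = 0 := le_antisymm hα (by rw [h2a]; exact huup)
      have hs00 : s = 0 := by
        have h6 : 0 < Real.sqrt 6 / 2 := by positivity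
        have : Real.sqrt 6 / 2 * s ≤ 0 := by rw [hα0, mul_zero] at h63; exact h63
        nlinarith only [this, h6, hs0]
      rw [hs00, mul_zero, zero_mul, zero_mul, zero_sub]
      have h1 : 0 ≤ (12 * Real.sqrt 2 * Real.pi + 36 * 10 + 55440) * ρ := mul_nonneg hCE0 hρ0
      have h2 : (0 : ℝ) ≤ 2860 * ((X.filter fun z => (X.filter fun q => dist z q = 1).card ≤ 11 ∧
          -10 - 2 ≤ z 2 ∧ z 2 ≤ h + 10 + 2).card : ℝ) := by positivity
      linarith only [h1, h2]
  have hPAY : ((X.filter fun z => (X.filter fun q => dist z q = 1).card ≤ 11 ∧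
        -10 - 2 ≤ z 2 ∧ z 2 ≤ h + 10 + 2).card : ℝ) ≤
      ((X.filter fun y => (X.filter fun q => dist y q = 1).card ≠ 12 ∧
        -10 - 2 ≤ y 2 ∧ y 2 ≤ h + 10 + 2).card : ℝ) := by
    exact_mod_cast card_le_card fun z hz => by
      rw [mem_filter] at hz ⊢
      exact ⟨hz.1, by have := hz.2.1; omega, hz.2.2⟩
  -- (5) the two splits of the skeleton
  have hs₁ := contactDeficiency_sdiff_split hP₁X
  have hs₂ := contactDeficiency_sdiff_split hP₂X₁
  -- (6) assemble
  have ha : C₁ * ρ ≤ |C₁| * (1 + h) * ρ := by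
    have h1 : C₁ * ρ ≤ |C₁| * ρ := mul_le_mul_of_nonneg_right (le_abs_self _) hρ0
    have h2 : 0 ≤ |C₁| * h * ρ := by positivity
    linarith only [h1, h2]
  have hb : C₂ * ρ ≤ |C₂| * (1 + h) * ρ := by
    have h1 : C₂ * ρ ≤ |C₂| * ρ := mul_le_mul_of_nonneg_right (le_abs_self _) hρ0
    have h2 : 0 ≤ |C₂| * h * ρ := by positivity
    linarith only [h1, h2]
  have hCE : (12 * Real.sqrt 2 * Real.pi + 36 * 10 + 55440) * ρ ≤
      (12 * Real.sqrt 2 * Real.pi + 36 * 10 + 55440) * (1 + h) * ρ := by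
    have := mul_nonneg (mul_nonneg hCE0 hh) hρ0
    linarith only [this]
  -- name the four counts
  set PAY : Finset (EuclideanSpace ℝ (Fin 3)) := X.filter fun z => (X.filter fun q => dist z q = 1).card ≤ 11 ∧
    -10 - 2 ≤ z 2 ∧ z 2 ≤ h + 10 + 2
  set PAY' : Finset (EuclideanSpace ℝ (Fin 3)) := X.filter fun y => (X.filter fun q => dist y q = 1).card ≠ 12 ∧
    -10 - 2 ≤ y 2 ∧ y 2 ≤ h + 10 + 2
  have t1 : ((((P₁ ×ˢ (X \ P₁)).filter fun pq => dist pq.1 pq.2 = 1).card : ℕ) : ℝ) +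
      ((((P₂ ×ˢ ((X \ P₁) \ P₂)).filter fun pq => dist pq.1 pq.2 = 1).card : ℕ) : ℝ) =
      contactDeficiency P₁ + contactDeficiency P₂ + contactDeficiency ((X \ P₁) \ P₂) -
        contactDeficiency X := by linarith only [hs₁, hs₂]
  have t2 : Real.sqrt 6 / 2 * s * Real.pi * ρ ^ 2 - (12 * Real.sqrt 2 * Real.pi + 36 * 10 + 55440) * ρ ≤
      2860 * (PAY'.card : ℝ) := by
    linarith only [hpay, hPAY]
  have t3 : 2 * φ₁ * Real.pi * ρ ^ 2 + 2 * φ₂ * Real.pi * ρ ^ 2 + (PAY'.card : ℝ) -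
      (240 * Real.sqrt 2 * Real.pi + 3120 * (4 * 10 + 2)) * (1 + h) * ρ ≤ 2 * contactDeficiency X := by
    linarith only [hled]
  have t4 : contactDeficiency P₁ ≤ 2 * φ₁ * Real.pi * ρ ^ 2 + C₁ * ρ := hD₁
  have t5 : contactDeficiency P₂ ≤ 2 * φ₂ * Real.pi * ρ ^ 2 + C₂ * ρ := hD₂
  linarith only [t1, t2, t3, t4, t5, ha, hb, hCE]

end Summit.Ventures.Crystal3D.Theorems

end
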